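import Summits.CriticalPhenomena.SAWScalingLimit.Theorems.BoundaryTP2.Negative.TP2CertGraph
import Summits.CriticalPhenomena.SAWScalingLimit.Theorems.LeftRightFKG.Negative.PolyCert
import Summits.CriticalPhenomena.SAWScalingLimit.Theorems.LeftRightFKG.Negative.RectMesh
import Summits.CriticalPhenomena.SAWScalingLimit.Theorems.SAWLeftRightFKGLeftRightFKGThreePointCert
import Summits.CriticalPhenomena.SAWScalingLimit.Theorems.SAWLeftRightFKGLeftRightFKGBoxLeafThreePoint
import HarnessLib

/-!
# Crux `LeftRightFKG` (stmt-CriticalPhenomena-11232), line `corner-localisation` (lead c4, v9h):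
the `5 × 4` notched-box certificate (`stub_notch54Cert`, T10, certified compute)

THE INSTANCE. Sites: the open box `(0,6) × (0,5)` of `ℤ²` (the `5 × 4` sites `{1..5} × {1..4}`) minus
`{(3,1), (2,1), (3,2)}` — 17 sites; `G` is ANY graph on `Site 2` whose adjacency is lattice adjacency inside that
set (the free graph of the notched-box instance of the lead's skeleton). Points `W = (1,1)`, `v = (2,2)`,
`E_b = (4,2)`, `N_b = (3,3)`; `Z = pathKernel G x` (self-avoiding path kernel, fugacity `x`).

CLAIM (proved here, kernel-checked, `decide +kernel` only — no `native_decide`): for every real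
`61/100 ≤ x ≤ 1`,

  `Z(W,E_b) + Z(W,N_b) < Z(W,v) · (Z(v,E_b) + Z(v,N_b))`.

EXACT DATA (kernel enumeration by the sibling crux's proved-complete / proved-sound / duplicate-free
enumerator `Cert.pathsV`, `Cert.pathCountV`, `Cert.pathKernel_eq_evPolyV`; 621 self-avoiding paths start at
`W`, 628 at `v`; entry `k` = number of `k`-step paths; reproduces an independent off-line enumeration):

* `Z(W,v)   = [0,0,1,0,1,0,1,0,1,0,1,0,1,0,1,0,1]`
* `Z(v,E_b) = [0,0,0,0,1,0,5,0,18,0,26,0,21,0,6]`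
* `Z(v,N_b) = [0,0,1,0,2,0,5,0,4,0,4,0,4,0,3]`
* `Z(W,E_b) = [0,0,0,0,0,0,2,0,11,0,26,0,27,0,10,0,1]`
* `Z(W,N_b) = [0,0,0,0,2,0,4,0,4,0,4,0,4,0,4,0,1]`

so `R·Q − P = [0,0,0,0,-1,0,-2,0,-1,0,6,0,35,0,77,0,98,0,100,0,99,0,96,0,86,0,64,0,34,0,9]`
(`R = Z(W,v)`, `Q = Z(v,E_b)+Z(v,N_b) = [0,0,1,0,3,0,10,0,22,0,30,0,25,0,9]`,
`P = Z(W,E_b)+Z(W,N_b) = [0,0,0,0,2,0,6,0,15,0,30,0,31,0,14,0,2]`): one sign change, root in `(0.60, 0.61)`,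
value `+0.0084` at `61/100`, `+0.078` at `5/8`, `+700` at `1`. Positivity on `[61/100, 1]` is ONE run of the
tree's validated-numerics sign checker `PolyMP.posOn` (interval Taylor shift + tail bound + bisection, soundness
`PolyMP.posOn_sound`; adapter `PolyCert.minorI` / `PolyCert.minor_pos_of_posOn` with `m₂₁ = [1]`, bridge
`ThreePoint.evalR_realOf_map_natCast`), scale `2^128`, depth `10` (depth `5`, 19 cells, already suffices
off-line).

USE. With the lead's `notchThreePoint_of_PA` (left–right positive association `PA x` forces the REVERSE weak
inequality on every notched box) this certifies `¬ PA x` for all `61/100 ≤ x ≤ 1` — a whole interval of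
supercritical fugacities at which association fails. Everything here is elementary ("folklore"); no facts,
no definitions, no axioms beyond the kernel's `decide`.
-/

open Literature.Probability.LatticeModels Literature.Probability.RandomPlanarGeometry
open Summit.CriticalPhenomena.SAWScalingLimit.Theorems.LeftRightFKG.Negative (bx pathCross wcross)
open Summit.CriticalPhenomena.SAWScalingLimit.Theorems.LeftRightFKG.CornerLoc
open Summit.CriticalPhenomena.SAWScalingLimit.Theorems.BoundaryTP2 (pathKernel pathKernelOn)
open Summit.CriticalPhenomena.SAWScalingLimit.Theorems.BoundaryTP2.Negative.Cert (evPoly evPoly_cons evPoly_nil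
  evPoly_nonneg pathCountV pathKernel_eq_evPolyV)
open Literature.Analysis.ValidatedNumerics
open scoped ENNReal

namespace Summit.CriticalPhenomena.SAWScalingLimit.Theorems.LeftRightFKG.Families

namespace Notch54Cert

/-! ## The carrier -/

/-- The carrier in coordinates: `(i,j)` is in the notched box iff it is one of the 17 listed pairs (finite
check, `5 × 4` ground cases). [folklore] -/
theorem coord_iff (i j : ℤ) :
    (((0 < i ∧ i < 6) ∧ (0 < j ∧ j < 5)) ∧ ¬ (i = 3 ∧ j = 1 ∨ i = 2 ∧ j = 1 ∨ i = 3 ∧ j = 2)) ↔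
    (i = 1 ∧ j = 1 ∨ i = 4 ∧ j = 1 ∨ i = 5 ∧ j = 1 ∨ i = 1 ∧ j = 2 ∨ i = 2 ∧ j = 2 ∨ i = 4 ∧ j = 2 ∨
      i = 5 ∧ j = 2 ∨ i = 1 ∧ j = 3 ∨ i = 2 ∧ j = 3 ∨ i = 3 ∧ j = 3 ∨ i = 4 ∧ j = 3 ∨ i = 5 ∧ j = 3 ∨
      i = 1 ∧ j = 4 ∨ i = 2 ∧ j = 4 ∨ i = 3 ∧ j = 4 ∨ i = 4 ∧ j = 4 ∨ i = 5 ∧ j = 4) := by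
  constructor
  · rintro ⟨⟨⟨h1, h2⟩, h3, h4⟩, h5⟩
    have hi : i = 1 ∨ i = 2 ∨ i = 3 ∨ i = 4 ∨ i = 5 := by omega
    have hj : j = 1 ∨ j = 2 ∨ j = 3 ∨ j = 4 := by omega
    rcases hi with rfl | rfl | rfl | rfl | rfl <;> rcases hj with rfl | rfl | rfl | rfl <;> revert h5 <;> decide
  · rintro (⟨rfl, rfl⟩ | ⟨rfl, rfl⟩ | ⟨rfl, rfl⟩ | ⟨rfl, rfl⟩ | ⟨rfl, rfl⟩ | ⟨rfl, rfl⟩ | ⟨rfl, rfl⟩ | ⟨rfl, rfl⟩ |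
      ⟨rfl, rfl⟩ | ⟨rfl, rfl⟩ | ⟨rfl, rfl⟩ | ⟨rfl, rfl⟩ | ⟨rfl, rfl⟩ | ⟨rfl, rfl⟩ | ⟨rfl, rfl⟩ | ⟨rfl, rfl⟩ |
      ⟨rfl, rfl⟩) <;> decide

/-! ## The kernel data: carrier, site list, five exact two-point polynomials -/

set_option maxHeartbeats 0 in
/-- **Certificate data** for the site list `VS` of the notched box (a literal, written once; in the order rows
`y = 1, 2, 3, 4`): (i) the notched box `(0,6) × (0,5) ∖ {(3,1),(2,1),(3,2)}` is exactly the listed set;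
(ii) no duplicates; (iii) `W = (1,1)` and `v = (2,2)` are listed; (iv) the five exact coefficient vectors
`Z(W,v)`, `Z(W,E_b)`, `Z(W,N_b)`, `Z(v,E_b)`, `Z(v,N_b)` (`E_b = (4,2)`, `N_b = (3,3)`; entry `k` = number of
`k`-step self-avoiding paths), by ONE kernel evaluation of the sibling's enumerator (`decide +kernel`). [folklore] -/
theorem cert54 : ∀ VS : List (Site 2),
    VS = [bx 1 1, bx 4 1, bx 5 1, bx 1 2, bx 2 2, bx 4 2, bx 5 2, bx 1 3, bx 2 3, bx 3 3, bx 4 3, bx 5 3,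
      bx 1 4, bx 2 4, bx 3 4, bx 4 4, bx 5 4] →
    (∀ p : Site 2, p ∈ Negative.Rect.box 0 6 0 5 \ {bx 3 1, bx 2 1, bx 3 2} ↔ p ∈ VS) ∧ VS.Nodup ∧
    bx 1 1 ∈ VS ∧ bx 2 2 ∈ VS ∧
    pathCountV VS (bx 1 1) (bx 2 2) = [0, 0, 1, 0, 1, 0, 1, 0, 1, 0, 1, 0, 1, 0, 1, 0, 1] ∧
    pathCountV VS (bx 1 1) (bx 4 2) = [0, 0, 0, 0, 0, 0, 2, 0, 11, 0, 26, 0, 27, 0, 10, 0, 1] ∧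
    pathCountV VS (bx 1 1) (bx 3 3) = [0, 0, 0, 0, 2, 0, 4, 0, 4, 0, 4, 0, 4, 0, 4, 0, 1] ∧
    pathCountV VS (bx 2 2) (bx 4 2) = [0, 0, 0, 0, 1, 0, 5, 0, 18, 0, 26, 0, 21, 0, 6] ∧
    pathCountV VS (bx 2 2) (bx 3 3) = [0, 0, 1, 0, 2, 0, 5, 0, 4, 0, 4, 0, 4, 0, 3] := by
  rintro VS rfl
  refine ⟨fun p => ?_, by decide +kernel⟩
  rw [Negative.eq_bx p]
  generalize p 0 = i, p 1 = j
  simp only [Set.mem_sdiff, Negative.Rect.box, Set.mem_setOf_eq, Negative.bx_zero, Negative.bx_one,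
    Set.mem_insert_iff, Set.mem_singleton_iff, List.mem_cons, List.not_mem_nil, or_false,
    BoxLeafThreePoint.bx_eq_iff]
  exact coord_iff i j

/-! ## The sign certificate of `R·Q − P` on `[61/100, 1]` -/

set_option maxHeartbeats 0 in
/-- Kernel certificate: the tree's sign checker accepts the interval polynomial of `R·Q − P·1` on the window
`[61/100, 1]` (scale `2^128`, bisection depth `10`; `R = Z(W,v)`, `Q = Z(v,E_b)+Z(v,N_b)`,
`P = Z(W,E_b)+Z(W,N_b)` as integer lists). [folklore] -/
theorem notch54_posOn :
    PolyMP.posOn (2 ^ 128) 10 (Negative.PolyCert.minorI (2 ^ 128)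
      (([0, 0, 1, 0, 1, 0, 1, 0, 1, 0, 1, 0, 1, 0, 1, 0, 1] : List ℕ).map fun n : ℕ => (n : ℤ))
      (([0, 0, 1, 0, 3, 0, 10, 0, 22, 0, 30, 0, 25, 0, 9] : List ℕ).map fun n : ℕ => (n : ℤ))
      (([0, 0, 0, 0, 2, 0, 6, 0, 15, 0, 30, 0, 31, 0, 14, 0, 2] : List ℕ).map fun n : ℕ => (n : ℤ)) [1])
      (61 / 100) 1 = true := by
  decide +kernel

/-- `P` is the sum of the two `W`-polynomials (coefficientwise). [folklore] -/
theorem evPoly_P (x : ℝ) : evPoly [0, 0, 0, 0, 2, 0, 6, 0, 15, 0, 30, 0, 31, 0, 14, 0, 2] x =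
    evPoly [0, 0, 0, 0, 0, 0, 2, 0, 11, 0, 26, 0, 27, 0, 10, 0, 1] x +
      evPoly [0, 0, 0, 0, 2, 0, 4, 0, 4, 0, 4, 0, 4, 0, 4, 0, 1] x := by
  simp only [evPoly_cons, evPoly_nil]
  push_cast
  ring

/-- `Q` is the sum of the two `v`-polynomials (coefficientwise). [folklore] -/
theorem evPoly_Q (x : ℝ) : evPoly [0, 0, 1, 0, 3, 0, 10, 0, 22, 0, 30, 0, 25, 0, 9] x =
    evPoly [0, 0, 0, 0, 1, 0, 5, 0, 18, 0, 26, 0, 21, 0, 6] x +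
      evPoly [0, 0, 1, 0, 2, 0, 5, 0, 4, 0, 4, 0, 4, 0, 3] x := by
  simp only [evPoly_cons, evPoly_nil]
  push_cast
  ring

/-- **The real inequality** `P(x) < R(x) · Q(x)` for every real `61/100 ≤ x ≤ 1`, with `P`, `Q` split into
their two summands (`Z(W,E_b) + Z(W,N_b) < Z(W,v) · (Z(v,E_b) + Z(v,N_b))` as polynomials). [folklore] -/
theorem notch54_real {x : ℝ} (hlo : (61 / 100 : ℝ) ≤ x) (hhi : x ≤ 1) :
    evPoly [0, 0, 0, 0, 0, 0, 2, 0, 11, 0, 26, 0, 27, 0, 10, 0, 1] x +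
        evPoly [0, 0, 0, 0, 2, 0, 4, 0, 4, 0, 4, 0, 4, 0, 4, 0, 1] x <
      evPoly [0, 0, 1, 0, 1, 0, 1, 0, 1, 0, 1, 0, 1, 0, 1, 0, 1] x *
        (evPoly [0, 0, 0, 0, 1, 0, 5, 0, 18, 0, 26, 0, 21, 0, 6] x +
          evPoly [0, 0, 1, 0, 2, 0, 5, 0, 4, 0, 4, 0, 4, 0, 3] x) := by
  have h := Negative.PolyCert.minor_pos_of_posOn (x := x) (by norm_num) notch54_posOn (by norm_num)
    (by push_cast; exact hlo) (by exact_mod_cast hhi)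
  rw [ThreePoint.evalR_realOf_map_natCast, ThreePoint.evalR_realOf_map_natCast,
    ThreePoint.evalR_realOf_map_natCast, ThreePoint.evalR_realOf_one, mul_one, evPoly_P, evPoly_Q] at h
  exact h

end Notch54Cert

open Notch54Cert in
/-- REGISTERED STUB T10 `stub_notch54Cert` of line `corner-localisation` (lead c4; certified compute, kernel
`decide` only): on ANY graph `G` on `Site 2` whose adjacency is lattice adjacency inside the 17-site set
`(0,6)×(0,5) ∖ {(3,1),(2,1),(3,2)}`, for every real `61/100 ≤ x ≤ 1`,
`Z_G(W,E_b) + Z_G(W,N_b) < Z_G(W,v)·(Z_G(v,E_b) + Z_G(v,N_b))` with `W = (1,1)`, `v = (2,2)`, `E_b = (4,2)`,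
`N_b = (3,3)`, `Z_G = pathKernel G x`. [folklore] -/
theorem stub_notch54Cert : ∀ (G : SimpleGraph (Site 2)) (x : ℝ),
    (∀ p q : Site 2, G.Adj p q ↔ (zdGraph 2).Adj p q ∧
      p ∈ Negative.Rect.box 0 6 0 5 \ {bx 3 1, bx 2 1, bx 3 2} ∧ q ∈ Negative.Rect.box 0 6 0 5 \ {bx 3 1, bx 2 1, bx 3 2}) →
    (61 / 100 : ℝ) ≤ x → x ≤ 1 →
    pathKernel G x (bx 1 1) (bx 4 2) + pathKernel G x (bx 1 1) (bx 3 3) <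
      pathKernel G x (bx 1 1) (bx 2 2) * (pathKernel G x (bx 2 2) (bx 4 2) + pathKernel G x (bx 2 2) (bx 3 3)) := by
  intro G x hG hlo hhi
  have hx : (0 : ℝ) ≤ x := le_trans (by norm_num) hlo
  obtain ⟨hmem, hnd, hW, hv, h1, h2, h3, h4, h5⟩ := cert54 _ rfl
  simp only [hmem] at hG
  rw [pathKernel_eq_evPolyV hG hnd hW hx, pathKernel_eq_evPolyV hG hnd hW hx, pathKernel_eq_evPolyV hG hnd hW hx,
    pathKernel_eq_evPolyV hG hnd hv hx, pathKernel_eq_evPolyV hG hnd hv hx, h1, h2, h3, h4, h5,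
    ← ENNReal.ofReal_add (evPoly_nonneg _ hx) (evPoly_nonneg _ hx),
    ← ENNReal.ofReal_add (evPoly_nonneg _ hx) (evPoly_nonneg _ hx),
    ← ENNReal.ofReal_mul (evPoly_nonneg _ hx),
    ENNReal.ofReal_lt_ofReal_iff_of_nonneg (add_nonneg (evPoly_nonneg _ hx) (evPoly_nonneg _ hx))]
  exact notch54_real hlo hhi

end Summit.CriticalPhenomena.SAWScalingLimit.Theorems.LeftRightFKG.Families
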